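import Literature.Topology.FourManifolds.SimplifiedBrokenLefschetzSphereSideTube
import Literature.Topology.FourManifolds.SphereFourFibredRegluing
import Literature.Geometry.Manifold.SmoothPinchMap
import HarnessLib

/-!
# Baykur–Kamada's Lemma 11 for `π₁ = 1` WITHOUT Laudenbach–Poénaru: reduction to a fibred
# identification of the complementary tube with `B³ × S¹`

Topic `Literature/Topology/FourManifolds`; brick for the named fact
`Literature.Topology.FourManifolds.nonempty_diffeomorph_sphere_four_of_sblf_genus_one_noLefschetz`
(`SimplifiedBrokenLefschetzFibration.lean`): a simply connected closed `4`-manifold carrying a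
genus-one simplified broken Lefschetz fibration without Lefschetz points is diffeomorphic to
`S⁴` (Baykur–Kamada 2015, Lemma 11 with Cor. 14; Hayano 2011, Cor. 4.11).  Everything here is
**proved**; no named fact is introduced.

The tree's reduction of this fact
(`nonempty_diffeomorph_sphere_four_of_sblf_genus_one_noLefschetz_of_laudenbachPoenaru_of_polarHandlebody`,
`SimplifiedBrokenLefschetzSphereSideTube.lean` §4) splits `X = B ∪ K` along the regular level
`⟪v, f⟫ = -1/2` of the height of the fibration towards a pole `v`, identifies the sphere-side
tube `B` with the equatorial tube `W₀ ≅ S² × D²` of `S⁴` by the explicit diffeomorphism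
`SphereSideTube.tubeDiffeomorph` (`x = ι(θ, w) ↤ (θ, w)`), and then needs two inputs: a
`(1, 1)`-handle decomposition of the complementary tube `K = {⟪v, f⟫ ≥ -1/2}` **and the
Laudenbach–Poénaru extension theorem** (`exists_diffeomorph_comp_incl_eq`, which contains Cerf's
`Γ₄ = 0`) to absorb the unknown gluing diffeomorphism of `S² × S¹`.

The present file gives the **Laudenbach–Poénaru-free variant**
(`nonempty_diffeomorph_sphere_four_of_sblf_genus_one_noLefschetz_of_fibredPolarTube`): the named
fact follows from the single geometric input

* `hK`: for every such fibration (same binders as in the tree's reduction) there is a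
  diffeomorphism `Θ : K ≅ V₀` onto the polar tube `V₀ = {x₃² + x₄² ≥ 1/2} ≅ B³ × S¹` of `S⁴`
  which, **on the boundary level `⟪v, f⟫ = -1/2`, carries the base coordinate of the fibration
  to the base coordinate `(x₃, x₄)` of `V₀`**: `(x₃, x₄)(Θ k) = β_v (f k)`, where
  `β_v = (univBall 0 2)⁻¹ ∘ σ_v : S² ∖ {v} → ℝ²` is the chart of the base in which the sphere side
  is the product `ι : S² × ℝ² ≅ f⁻¹{⟪·, v⟫ < 0}`, `f (ι(θ, w)) = β_v⁻¹ w`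
  (written out, no definition is introduced).  In words: `K` is `B³ × S¹` *fibrewise over the round image
  circle on its boundary* — Auroux–Donaldson–Katzarkov's "`X_- ∪ W ≃ S¹ × B³`" (2005, §8.2,
  Ex. 1) together with the compatibility of this identification with the fibration on `∂K`,
  which is how the genus-one fibration of `S⁴` is built (ibid.; Baykur–Kamada 2015, §5).

Given `hK`, the gluing map `∂W₀ → ∂V₀` of `X = W₀ ∪ V₀` transported along
`SphereSideTube.tubeDiffeomorph` and `Θ` preserves the base circle coordinate (§1: on the
boundary of `W₀` the tube diffeomorphism is `(θ, (x₃, x₄)) ↦ ι(θ, (x₃, x₄))`,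
`invTail_apply_boundary`), so it is a circle family of diffeomorphisms of the fibre `S²`, and
`SphereFourSplitting.nonempty_diffeomorph_sphere_four_of_isBoundaryGluing_of_fibredDiffeomorphs`
(`SphereFourFibredRegluing.lean`: Smale's theorem in families via Cerf 1968, App., Cor. 2, and
Gluck's extension of rotation loops over `B³ × S¹`) gives `X ≅ S⁴` — with no appeal to
Laudenbach–Poénaru or `Γ₄ = 0`.

## References

* R. İ. Baykur, S. Kamada, *Classification of broken Lefschetz fibrations with small fiber
  genera*, J. Math. Soc. Japan 67 (2015), Lemma 11, Cor. 14, §5. [BaykurKamada2015]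
* K. Hayano, *On genus-1 simplified broken Lefschetz fibrations*, Algebr. Geom. Topol. 11 (2011),
  Cor. 4.11. [Hayano2011]
* D. Auroux, S. K. Donaldson, L. Katzarkov, *Singular Lefschetz pencils*, Geom. Topol. 9 (2005),
  §8.2, Example 1. [AurouxDonaldsonKatzarkov2005]
* H. Gluck, *The embedding of two-spheres in the four-sphere*, Trans. AMS 104 (1962), §5.
  [Gluck1962]
* J. Milnor, *Morse theory* (1963), Thm. 3.1. [Milnor1963]
-/

open scoped Manifold ContDiff Topology RealInnerProductSpace
open Set Function Metric Module
open Literature.AlgebraicTopology.SingularHomology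

-- `Literature.Geometry.Manifold.SmoothPinchMap` is imported because it registers, globally,
-- `factFinrankEuclideanSucc : Fact (finrank ℝ (EuclideanSpace ℝ (Fin (n + 1))) = n + 1)`, on which
-- Mathlib's sphere charts and `stereographic'` are keyed.

noncomputable section

namespace Literature.Topology.FourManifolds

namespace SphereSideTube

open SphereFourSplitting

/-! ### §1 The base coordinate of the fibration and the tube diffeomorphism on the boundary -/

variable {X : Type} {f : X → Metric.sphere (0 : EuclideanSpace ℝ (Fin 3)) 1}
  {v : Metric.sphere (0 : EuclideanSpace ℝ (Fin 3)) 1}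
  {ιX : Metric.sphere (0 : EuclideanSpace ℝ (Fin 3)) 1 × EuclideanSpace ℝ (Fin 2) → X}

/-- **The base coordinate of a point of the sphere side is its `ℝ²`-component**:
`β_v (f (ι(θ, w))) = w`. [folklore] -/
theorem baseCoord_apply_ιX
    (hιf : ∀ p, f (ιX p) =
      (stereographic' 2 v).symm (OpenPartialHomeomorph.univBall (0 : EuclideanSpace ℝ (Fin 2)) 2 p.2))
    (p : Metric.sphere (0 : EuclideanSpace ℝ (Fin 3)) 1 × EuclideanSpace ℝ (Fin 2)) :
    (OpenPartialHomeomorph.univBall (0 : EuclideanSpace ℝ (Fin 2)) 2).symm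
      (stereographic' 2 v (f (ιX p))) = p.2 := by
  rw [hιf, (stereographic' 2 v).right_inv (by rw [stereographic'_target]; trivial),
    (OpenPartialHomeomorph.univBall (0 : EuclideanSpace ℝ (Fin 2)) 2).left_inv
      (by rw [OpenPartialHomeomorph.univBall_source]; trivial)]

/-- On the boundary level torus `∂W₀ = {u = 1/2}` the radius `√(1 - u)` is `1/√2`. [folklore] -/
theorem rad_boundary (z : (𝓡∂ 4).boundary EquatorTube) : rad z.1 = (√2)⁻¹ := by
  have h : tubeS (ιW z.1) = 1 / 2 := RegularSublevel.apply_incl_boundary isRegularLevel_tubeS z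
  rw [rad, h, show (1 : ℝ) - 1 / 2 = 2⁻¹ by norm_num, Real.sqrt_inv]

/-- `√2 · rad = 1` on the boundary level torus. [folklore] -/
theorem sqrt_two_mul_rad_boundary (z : (𝓡∂ 4).boundary EquatorTube) : √2 * rad z.1 = 1 := by
  rw [rad_boundary, mul_inv_cancel₀]
  exact Real.sqrt_ne_zero'.2 two_pos

/-- **On the boundary of `W₀` the `ℝ²`-component of the inverse parametrisation is `(x₃, x₄)`
itself**: `invTail x = (x₃, x₄)/(√2 · √(1 - u(x))) = (x₃, x₄)` at `u = 1/2`. [folklore] -/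
theorem invTail_apply_boundary (z : (𝓡∂ 4).boundary EquatorTube) (j : Fin 2) :
    invTail z.1 j = ι (ιW z.1) (Fin.natAdd 3 j) := by
  fin_cases j
  · show invTail z.1 0 = ι (ιW z.1) 3
    rw [invTail_apply_zero, sqrt_two_mul_rad_boundary, inv_one, one_mul]
  · show invTail z.1 1 = ι (ιW z.1) 4
    rw [invTail_apply_one, sqrt_two_mul_rad_boundary, inv_one, one_mul]

variable [TopologicalSpace X] [ChartedSpace (EuclideanSpace ℝ (Fin 4)) X] [IsManifold (𝓡 4) ∞ X]

/-- **The transported gluing map preserves the base coordinates.**  Let `B = {⟪v, f⟫ ≤ -1/2}`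
and `K = {⟪v, f⟫ ≥ -1/2}` be the two sides of the boundary level, `Ξ : W₀ ≅ B` the tube
diffeomorphism `(θ, w) ↦ ι(θ, w)` and `Θ : K ≅ V₀` a diffeomorphism carrying, on the level
`⟪v, f⟫ = -1/2`, the base coordinate `β_v ∘ f` to `(x₃, x₄)`.  Then the gluing map
`∂Θ ∘ (∂B ≡ ∂K) ∘ ∂Ξ : ∂W₀ → ∂V₀` preserves the coordinates `x₃, x₄` of `ℝ⁵`. [folklore] -/
theorem coord_restrictDiffeomorph_fibred
    (hemb : Manifold.IsSmoothEmbedding ((𝓡 2).prod (𝓡 2)) (𝓡 4) ∞ ιX)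
    (hrange : range ιX =
      f ⁻¹' {y | ⟪(y : EuclideanSpace ℝ (Fin 3)), (v : EuclideanSpace ℝ (Fin 3))⟫ < 0})
    (hιf : ∀ p, f (ιX p) =
      (stereographic' 2 v).symm (OpenPartialHomeomorph.univBall (0 : EuclideanSpace ℝ (Fin 2)) 2 p.2))
    (hg : IsRegularLevel (𝓡 4) (SphereHeight.height (v : EuclideanSpace ℝ (Fin 3)) ∘ f) (-1 / 2))
    (Θ : RegularSuperlevel hg ≃ₘ⟮𝓡∂ 4, 𝓡∂ 4⟯ PolarTube)
    (hΘ : ∀ k : RegularSuperlevel hg,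
      (SphereHeight.height (v : EuclideanSpace ℝ (Fin 3)) ∘ f) (RegularSublevel.incl hg.const_sub k) =
          -1 / 2 →
        ∀ j : Fin 2, ι (ιV (Θ k)) (Fin.natAdd 3 j) =
          (OpenPartialHomeomorph.univBall (0 : EuclideanSpace ℝ (Fin 2)) 2).symm
            (stereographic' 2 v (f (RegularSublevel.incl hg.const_sub k))) j)
    (z : LevelTorusW) (j : Fin 2) :
    Xv ((RegularSublevel.boundaryData hg.const_sub).restrictDiffeomorph bV Θ
        (RegularSublevel.splitDiffeomorph hg
          (bW.restrictDiffeomorph (RegularSublevel.boundaryData hg)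
            (tubeDiffeomorph hemb hrange hιf hg) z))) (Fin.natAdd 3 j) =
      Xw z (Fin.natAdd 3 j) := by
  -- the boundary point of `B` under `Ξ` and the corresponding boundary point of `K`
  set b := bW.restrictDiffeomorph (RegularSublevel.boundaryData hg) (tubeDiffeomorph hemb hrange hιf hg) z
    with hb_def
  have hb : RegularSublevel.incl hg b.1 = ιX (invParam z.1) := by
    have hincl := BoundaryData.incl_restrictDiffeomorph (b₁ := bW)
      (b₂ := RegularSublevel.boundaryData hg) (tubeDiffeomorph hemb hrange hιf hg) z
    rw [RegularSublevel.boundaryData_incl, RegularSublevel.boundaryData_incl] at hincl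
    rw [← hb_def] at hincl
    rw [show b.1 = tubeDiffeomorph hemb hrange hιf hg z.1 from hincl]
    rfl
  set k := (RegularSublevel.splitDiffeomorph hg b).1 with hk_def
  have hk : RegularSublevel.incl hg.const_sub k = ιX (invParam z.1) := by
    rw [hk_def, RegularSublevel.incl_splitDiffeomorph, hb]
  have hlev : (SphereHeight.height (v : EuclideanSpace ℝ (Fin 3)) ∘ f)
      (RegularSublevel.incl hg.const_sub k) = -1 / 2 := by
    rw [hk_def, RegularSublevel.incl_splitDiffeomorph]
    exact RegularSublevel.apply_incl_boundary hg b
  -- the boundary point of `V₀`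
  have hkb : Xv ((RegularSublevel.boundaryData hg.const_sub).restrictDiffeomorph bV Θ
      (RegularSublevel.splitDiffeomorph hg b)) = ι (ιV (Θ k)) := by
    have hincl := BoundaryData.incl_restrictDiffeomorph
      (b₁ := RegularSublevel.boundaryData hg.const_sub) (b₂ := bV) Θ
      (RegularSublevel.splitDiffeomorph hg b)
    rw [RegularSublevel.boundaryData_incl, RegularSublevel.boundaryData_incl] at hincl
    show ι (ιV _) = _
    rw [hincl]
  rw [hkb, hΘ k hlev j, hk, baseCoord_apply_ιX hιf, invParam]
  show invTail z.1 j = _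
  rw [invTail_apply_boundary]
  rfl

end SphereSideTube

/-! ### §2 The Laudenbach–Poénaru-free reduction -/

/-- **Baykur–Kamada's Lemma 11 in the simply connected case (with Cor. 14), reduced — without
Laudenbach–Poénaru — to a fibred identification of the complementary tube with `B³ × S¹`.**
The named fact `nonempty_diffeomorph_sphere_four_of_sblf_genus_one_noLefschetz` (a simply
connected closed `4`-manifold carrying a genus-one simplified broken Lefschetz fibration without
Lefschetz singularities is diffeomorphic to `S⁴`) follows from the following statement `hK`,
spelled out as a hypothesis and NOT vendored as a fact: for every such fibration `f : X → S²` on a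
simply connected closed `X : Type` with equatorial round image, pole `v` and product
parametrisation `ι` of the sphere side as produced by
`exists_pole_isRegularLevel_nonempty_diffeomorph_equatorTube`,
the complementary tube `K = {⟪v, f⟫ ≥ -1/2}` (the torus side together with the round cobordism;
Auroux–Donaldson–Katzarkov's `X_- ∪ W ≃ S¹ × B³`, Baykur–Kamada's `X_h ∪ W`) admits a
diffeomorphism `Θ` onto the polar tube `V₀ = {x₃² + x₄² ≥ 1/2} ≅ B³ × S¹` of `S⁴` which on the
boundary level `⟪v, f⟫ = -1/2` carries the base coordinate `β_v ∘ f` of the fibration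
(`β_v = (univBall 0 2)⁻¹ ∘ σ_v`, written out; `f (ι(θ, w)) = β_v⁻¹ w`) to the base coordinate
`(x₃, x₄)` of `V₀`.

Proof: normalise the round image to the equator (`exists_image_round_eq_sphereEquator`), split
`X = B ∪ K` along the regular level `⟪v, f⟫ = -1/2` (`RegularSublevel.isBoundaryGluing_split`,
Milnor 1963, Thm. 3.1), identify `B ≅ W₀` by `SphereSideTube.tubeDiffeomorph` and `K ≅ V₀` by
`Θ`; the transported gluing map `∂W₀ → ∂V₀` preserves `(x₃, x₄)`
(`SphereSideTube.coord_restrictDiffeomorph_fibred`), and a gluing `W₀ ∪_χ V₀` with `χ` fibred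
over the base circle is `S⁴`
(`SphereFourSplitting.nonempty_diffeomorph_sphere_four_of_isBoundaryGluing_of_fibredDiffeomorphs`:
Smale's theorem in families and Gluck's extension of rotation loops over `B³ × S¹`; no
Laudenbach–Poénaru, no `Γ₄ = 0`).
[cite: BaykurKamada2015, Lemma 11, Cor. 14 and §5] [cite: AurouxDonaldsonKatzarkov2005, §8.2 Example 1]
[cite: Gluck1962, §5] [cite: Milnor1963, Thm. 3.1] -/
theorem nonempty_diffeomorph_sphere_four_of_sblf_genus_one_noLefschetz_of_fibredPolarTube
    (hK : ∀ (X : Type) [TopologicalSpace X] [T2Space X] [SecondCountableTopology X] [CompactSpace X]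
        [ChartedSpace (EuclideanSpace ℝ (Fin 4)) X] [IsManifold (𝓡 4) ∞ X] [SimplyConnectedSpace X]
        (o : SmoothOrientation (𝓡 4) X) (f : X → Metric.sphere (0 : EuclideanSpace ℝ (Fin 3)) 1),
        IsSimplifiedBrokenLefschetzFibration o f ∅ 0 →
        f '' ({p : X | ¬ Surjective (mfderiv (𝓡 4) (𝓡 2) f p)} \ (↑(∅ : Finset X) : Set X)) =
          sphereEquator 1 →
        ∀ (v : Metric.sphere (0 : EuclideanSpace ℝ (Fin 3)) 1)
          (ιX : Metric.sphere (0 : EuclideanSpace ℝ (Fin 3)) 1 × EuclideanSpace ℝ (Fin 2) → X),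
        (v : EuclideanSpace ℝ (Fin 3)) 0 = 0 → (v : EuclideanSpace ℝ (Fin 3)) 1 = 0 →
        Manifold.IsSmoothEmbedding ((𝓡 2).prod (𝓡 2)) (𝓡 4) ∞ ιX →
        range ιX = f ⁻¹' {y | ⟪(y : EuclideanSpace ℝ (Fin 3)), (v : EuclideanSpace ℝ (Fin 3))⟫ < 0} →
        (∀ p, f (ιX p) =
          (stereographic' 2 v).symm (OpenPartialHomeomorph.univBall (0 : EuclideanSpace ℝ (Fin 2)) 2 p.2)) →
        (∀ y : Metric.sphere (0 : EuclideanSpace ℝ (Fin 3)) 1,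
          ⟪(y : EuclideanSpace ℝ (Fin 3)),
            ((-v : Metric.sphere (0 : EuclideanSpace ℝ (Fin 3)) 1) : EuclideanSpace ℝ (Fin 3))⟫ < 0 →
            (∀ q, f q = y → Surjective (mfderiv (𝓡 4) (𝓡 2) f q)) ∧
            Module.finrank ℤ (singularHomology ℤ ℤ ↥(f ⁻¹' {y}) 1) = 2) →
        ∀ hg : IsRegularLevel (𝓡 4) (SphereHeight.height (v : EuclideanSpace ℝ (Fin 3)) ∘ f) (-1 / 2),
        ∃ Θ : RegularSuperlevel hg ≃ₘ⟮𝓡∂ 4, 𝓡∂ 4⟯ SphereFourSplitting.PolarTube,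
          ∀ k : RegularSuperlevel hg,
            (SphereHeight.height (v : EuclideanSpace ℝ (Fin 3)) ∘ f) (RegularSublevel.incl hg.const_sub k) =
              -1 / 2 →
            ∀ j : Fin 2,
              SphereFourSplitting.ι (SphereFourSplitting.ιV (Θ k)) (Fin.natAdd 3 j) =
                (OpenPartialHomeomorph.univBall (0 : EuclideanSpace ℝ (Fin 2)) 2).symm
                  (stereographic' 2 v (f (RegularSublevel.incl hg.const_sub k))) j) :
    nonempty_diffeomorph_sphere_four_of_sblf_genus_one_noLefschetz := by
  intro X _ _ _ _ _ _ _ hX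
  obtain ⟨o, f₀, hf₀⟩ := hX
  obtain ⟨f, hf, hround⟩ := hf₀.exists_image_round_eq_sphereEquator
  obtain ⟨v, ιX, hv0, hv1, hemb, hrange, hιf, hhi, hg, -⟩ :=
    hf.exists_pole_isRegularLevel_nonempty_diffeomorph_equatorTube hround
  obtain ⟨Θ, hΘ⟩ := hK X o f hf hround v ιX hv0 hv1 hemb hrange hιf hhi hg
  exact SphereFourSplitting.nonempty_diffeomorph_sphere_four_of_isBoundaryGluing_of_fibredDiffeomorphs
    (RegularSublevel.isBoundaryGluing_split hg) (SphereSideTube.tubeDiffeomorph hemb hrange hιf hg) Θ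
    (fun z => SphereSideTube.coord_restrictDiffeomorph_fibred hemb hrange hιf hg Θ hΘ z 0)
    (fun z => SphereSideTube.coord_restrictDiffeomorph_fibred hemb hrange hιf hg Θ hΘ z 1)

end Literature.Topology.FourManifolds
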